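import Literature.Computability.QuantumComplexity.HidingProgramMachine
import HarnessLib

/-!
# The hiding program is polynomial time: `CodeFP` certificate of the post-processing

Family `quantum-advantage`, sequel of `HidingProgramMachine.lean`. The post-processing
`postFun H p₀ c_𝒪 : ((query, coins), counter's reply) ↦ z` of the `FBPP^{NP^𝒪}` machine of the
discharge of Aaronson–Arkhipov's Thm. 1.3 recomputes the planted array, reads the `d`'s of Cohen's
integer Gram–Schmidt table (`dProdOdd`, `dProdEven`), the oracle's coin length `ℓ` and the counter's
estimate `Ñ`, and returns `z = ⌊4ᵇ n! Ñ ∏d_odd / (2^ℓ 4^{bn} ∏d_even)⌋` (`zOf`). This file proves it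
is computed on codes in polynomial time (`postFun_codeFP`): products of integer lists under a
length budget (`intProd_codeFP`, `size_list_prod_le`), the factorial (`intFactorial_codeFP`), the
`d`-products (`dProd_codeFP`), the answer (`zOf_codeFP`).

All proved, no new named facts.

## References

* S. Aaronson, A. Arkhipov, *The computational complexity of linear optics*, Theory of Computing 9
  (2013) 143–252, proof of Thm. 1.3, eqs. (5.89), (5.93) (pp. 194–195).
* S. Arora, B. Barak, *Computational Complexity: A Modern Approach*, CUP 2009, §1.3.
-/

namespace Literature.Computability.QuantumComplexity

open Polynomial Literature.Computability.Complexity Literature.Computability.Complexity.CodeFP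
  Literature.Computability.Cryptography Literature.Probability.Distributions

/-! ### Products of integer lists -/

/-- The multiplying fold. [folklore] -/
theorem foldl_mul_eq_prod_int (l : List ℤ) (acc : ℤ) : l.foldl (fun acc a => acc * a) acc = acc * l.prod := by
  induction l generalizing acc with
  | nil => simp
  | cons a l ih => rw [List.foldl_cons, ih, List.prod_cons]; ring

/-- `|∏ l| = ∏ |·|`. [folklore] -/
theorem natAbs_list_prod (l : List ℤ) : l.prod.natAbs = (l.map Int.natAbs).prod := by
  induction l with
  | nil => simp
  | cons a l ih => rw [List.prod_cons, List.map_cons, List.prod_cons, Int.natAbs_mul, ih]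

/-- The size of a product is at most the sum of the sizes, plus one. [folklore] -/
theorem size_list_prod_le (L : List ℕ) : Nat.size L.prod ≤ (L.map Nat.size).sum + 1 := by
  induction L with
  | nil => simp
  | cons a L ih =>
    rw [List.prod_cons, List.map_cons, List.sum_cons]
    exact (size_mul_le a L.prod).trans (by omega)

/-- **Products of raw lists of integers** (the code of the product is no longer than the code of the
list, up to constants). [cite: AroraBarak2009, §1.3] -/
theorem intProd_codeFP : CodeFP (rawE intE) intE List.prod := by
  have hstep : CodeFP (pairE intE intE) intE (fun t => t.2 * t.1) := (intMul.comp ((snd _ _).pair (fst _ _)) :)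
  have h := foldl₀ (step := fun (a : ℤ) acc => acc * a) (b₀ := 1) hstep
    (3 * X + 5) (fun l₁ l₂ => by
      rw [foldl_mul_eq_prod_int, one_mul]
      simp only [eval_add, eval_mul, eval_X, eval_ofNat]
      set L := (rawE intE (l₁ ++ l₂)).length
      have hsum : ((l₁.map Int.natAbs).map Nat.size).sum ≤ L := by
        rw [List.map_map]
        refine le_trans ?_ (length_rawE_le_of_sublist intE (List.sublist_append_left l₁ l₂))
        rw [length_rawE]
        refine List.sum_le_sum (fun z _ => ?_)
        have := size_natAbs_le_length_intE z
        simp only [Function.comp_apply]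
        omega
      have hsize : Nat.size l₁.prod.natAbs ≤ L + 1 := by
        rw [natAbs_list_prod]
        exact (size_list_prod_le _).trans (by omega)
      have hlt : l₁.prod.natAbs < 2 ^ (L + 1) := Nat.size_le.1 hsize
      have := length_intE_le_of_natAbs_lt hlt
      omega)
  exact h.congr fun l => by rw [foldl_mul_eq_prod_int, one_mul]

/-- `n! = ∏_{c<n} (c + 1)` over the integers. [folklore] -/
theorem prod_range_succ_int (n : ℕ) : ((List.range n).map fun c : ℕ => ((c : ℤ) + 1)).prod = (n.factorial : ℤ) := by
  induction n with
  | zero => simp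
  | succ n ih => rw [List.range_succ, List.map_append, List.prod_append, ih, Nat.factorial_succ]; simp; ring

/-- **The factorial of a unary numeral, in binary.** [folklore] -/
theorem natFactorial_codeFP : CodeFP unE natE Nat.factorial := by
  have hmap : CodeFP unE (rawE intE) (fun n => (List.range n).map fun c : ℕ => ((c : ℤ) + 1)) := by
    have hg : CodeFP natE intE (fun c : ℕ => ((c : ℤ) + 1)) := by
      exact (intAdd.comp (intOfNat.pair (const _ (1 : ℤ))) :)
    exact ((map₀ hg).comp urange :)
  have h : CodeFP unE natE (fun n => (((List.range n).map fun c : ℕ => ((c : ℤ) + 1)).prod).toNat) := by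
    exact (intToNat.comp (intProd_codeFP.comp hmap) :)
  exact h.congr fun n => by rw [prod_range_succ_int, Int.toNat_natCast]

/-! ### The `d`-products of the planted array -/

/-- `∏_{c<n} d_{2c+a}` for a fixed shift `a`, from `(rows, n)`. [folklore] -/
theorem dProd_codeFP (a : ℕ) :
    CodeFP (pairE (rawE (rawE giE)) unE) intE (fun p => ((List.range p.2).map fun c => dOfL p.1 p.2 (2 * c + a)).prod) := by
  -- the levels list, computed once
  have hD : CodeFP (pairE (rawE (rawE giE)) unE) unE (fun p => p.1.length + p.1.length) := by
    exact (unAdd.comp (((ulength _).comp (fst _ _)).pair ((ulength _).comp (fst _ _))) :)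
  have hLs : CodeFP (pairE (rawE (rawE giE)) unE) (rawE (pairE intE (rawE (rawE intE))))
      (fun p => gsLevels p.1 p.2 (p.1.length + p.1.length)) := by
    exact (gsLevels_codeFP.comp ((snd _ _).pair (hD.pair (fst _ _))) :)
  -- one `d`, context the levels list
  have hget : CodeFP (pairE (rawE (pairE intE (rawE (rawE intE)))) natE) intE
      (fun t => (t.1.getD (2 * t.2 + a) (0, [])).1) := by
    have hidx' : CodeFP (pairE (rawE (pairE intE (rawE (rawE intE)))) natE) natE (fun t => t.2 + t.2 + a) := by
      exact (natAdd.comp ((natAdd.comp ((snd _ _).pair (snd _ _))).pair (const _ a)) :)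
    have hidx : CodeFP (pairE (rawE (pairE intE (rawE (rawE intE)))) natE) natE (fun t => 2 * t.2 + a) :=
      hidx'.congr fun t => by ring
    exact (((rawGetOr (pairE intE (rawE (rawE intE)))).comp ((fst _ _).pair (hidx.pair (const _ ((0 : ℤ), ([] : List (List ℤ))))))).fst' :)
  have hmap : CodeFP (pairE (rawE (rawE giE)) unE) (rawE intE)
      (fun p => (List.range p.2).map fun c => ((gsLevels p.1 p.2 (p.1.length + p.1.length)).getD (2 * c + a) (0, [])).1) := by
    exact ((map hget).comp (hLs.pair (urange.comp (snd _ _))) :)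
  have h : CodeFP (pairE (rawE (rawE giE)) unE) intE
      (fun p => ((List.range p.2).map fun c => ((gsLevels p.1 p.2 (p.1.length + p.1.length)).getD (2 * c + a) (0, [])).1).prod) := by
    exact (intProd_codeFP.comp hmap :)
  exact h.congr fun p => rfl

/-- `∏ d_odd`. [folklore] -/
theorem dProdOdd_codeFP : CodeFP (pairE (rawE (rawE giE)) unE) intE (fun p => dProdOdd p.1 p.2) :=
  (dProd_codeFP 1).congr fun _ => rfl

/-- `∏ d_even`. [folklore] -/
theorem dProdEven_codeFP : CodeFP (pairE (rawE (rawE giE)) unE) intE (fun p => dProdEven p.1 p.2) :=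
  (dProd_codeFP 0).congr fun _ => by simp only [dProdEven, Nat.add_zero]

/-! ### The answer -/

/-- The code of the arguments `(b, n, Ñ, ℓ, d_odd, d_even)` of `zOf`. [folklore] -/
abbrev zArgE : ℕ × ℕ × ℕ × ℕ × ℤ × ℤ → List Bool := pairE unE (pairE unE (pairE natE (pairE unE (pairE intE intE))))

/-- **The integer answer `zOf` is polynomial time on codes.** [folklore] -/
theorem zOf_codeFP : CodeFP zArgE natE (fun p => zOf p.1 p.2.1 p.2.2.1 p.2.2.2.1 p.2.2.2.2.1 p.2.2.2.2.2) := by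
  have hb : CodeFP zArgE unE (fun p => p.1) := fst _ _
  have hn : CodeFP zArgE unE (fun p => p.2.1) := (snd _ _).fst'
  have hN : CodeFP zArgE natE (fun p => p.2.2.1) := (snd _ _).snd'.fst'
  have hl : CodeFP zArgE unE (fun p => p.2.2.2.1) := (snd _ _).snd'.snd'.fst'
  have ho : CodeFP zArgE intE (fun p => p.2.2.2.2.1) := (snd _ _).snd'.snd'.snd'.fst'
  have he : CodeFP zArgE intE (fun p => p.2.2.2.2.2) := (snd _ _).snd'.snd'.snd'.snd'
  have hnum : CodeFP zArgE natE (fun p => 4 ^ p.1 * (p.2.1).factorial * p.2.2.1 * (p.2.2.2.2.1).toNat) := by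
    exact (natMul.comp ((natMul.comp ((natMul.comp ((natPow.comp ((const _ 4).pair hb)).pair
      (natFactorial_codeFP.comp hn))).pair hN)).pair (intToNat.comp ho)) :)
  have hden : CodeFP zArgE natE (fun p => 2 ^ p.2.2.2.1 * 4 ^ (p.1 * p.2.1) * (p.2.2.2.2.2).toNat) := by
    exact (natMul.comp ((natMul.comp ((natPow.comp ((const _ 2).pair hl)).pair
      (natPow.comp ((const _ 4).pair (unMul_codeFP.comp (hb.pair hn)))))).pair (intToNat.comp he)) :)
  exact ((natDiv.comp (hnum.pair hden)).congr fun p => rfl :)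

/-! ### The post-processing -/

section Top

variable (H : HPolys) (p₀ cO : Polynomial ℕ)

/-- The code of `((query, coins), reply)`. [folklore] -/
abbrev postE : (GIn × List Bool) × List Bool → List Bool := pairE inE strE

/-- **The post-processing of the machine is polynomial time on codes.** [cite: AaronsonArkhipovToC2013, proof of Thm. 1.3, eq. (5.93) (p. 195)] -/
theorem postFun_codeFP : CodeFP postE smE (postFun H p₀ cO) := by
  have hn : CodeFP postE unE (fun q => q.1.1.nC q.1.2) := by exact (nC_codeFP.comp (fst _ _) :)
  have hb : CodeFP postE unE (fun q => q.1.1.bC q.1.2) := by exact (bC_codeFP.comp (fst _ _) :)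
  have hN : CodeFP postE natE (fun q => Computability.decodeNat q.2) := by exact (decodeNat_codeFP.comp (snd _ _) :)
  have hl : CodeFP postE unE (fun q => ellTop H p₀ cO q.1.1 q.1.2) := by exact ((ellTop_codeFP H p₀ cO).comp (fst _ _) :)
  have hP : CodeFP postE (rawE (rawE giE)) (fun q => plantedTop H q.1.1 q.1.2) := by
    exact ((plantedTop_codeFP H).comp (fst _ _) :)
  have ho : CodeFP postE intE (fun q => dProdOdd (plantedTop H q.1.1 q.1.2) (q.1.1.nC q.1.2)) := by
    exact (dProdOdd_codeFP.comp (hP.pair hn) :)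
  have he : CodeFP postE intE (fun q => dProdEven (plantedTop H q.1.1 q.1.2) (q.1.1.nC q.1.2)) := by
    exact (dProdEven_codeFP.comp (hP.pair hn) :)
  have hz : CodeFP postE natE (fun q => zOf (q.1.1.bC q.1.2) (q.1.1.nC q.1.2) (Computability.decodeNat q.2)
      (ellTop H p₀ cO q.1.1 q.1.2) (dProdOdd (plantedTop H q.1.1 q.1.2) (q.1.1.nC q.1.2))
      (dProdEven (plantedTop H q.1.1 q.1.2) (q.1.1.nC q.1.2))) := by
    exact (zOf_codeFP.comp (hb.pair (hn.pair (hN.pair (hl.pair (ho.pair he))))) :)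
  have hzI : CodeFP postE smE (fun q => ((zOf (q.1.1.bC q.1.2) (q.1.1.nC q.1.2) (Computability.decodeNat q.2)
      (ellTop H p₀ cO q.1.1 q.1.2) (dProdOdd (plantedTop H q.1.1 q.1.2) (q.1.1.nC q.1.2))
      (dProdEven (plantedTop H q.1.1 q.1.2) (q.1.1.nC q.1.2)) : ℕ) : ℤ)) := by
    exact (smOfInt.comp (intOfNat.comp hz) :)
  have h0 : CodeFP postE smE (fun q => ((4 ^ q.1.1.bC q.1.2 : ℕ) : ℤ)) := by
    exact (smOfInt.comp (intOfNat.comp (natPow.comp ((const _ 4).pair hb))) :)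
  have hc : CodeFP postE bitE (fun q => decide (q.1.1.nC q.1.2 = 0)) := by
    exact (natEq.comp ((natOfUn.comp hn).pair (const _ 0)) :)
  have h := hc.ite h0 hzI
  refine h.congr fun q => ?_
  simp only [postFun, decide_eq_true_eq]

end Top

end Literature.Computability.QuantumComplexity
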